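import Mathlib
import Summits.Ventures.FusionMHD.Models.FluxSurfacePolarRayDeriv
import HarnessLib

/-!
# Polar-ray LOOP: periodic seam, `ρ ∈ C¹` on a panel for `ψ ∈ C¹`, and ★ #88's `(6.35)` identity
# `q = (F/2π) ∫₀^{2π} ρ/(R·|D_r|) dθ` for the GLUED ray radius — every surface at once

LADDER-GRIDFUSION (F2 item R2), cell `gridfusion`, seat `gridfusion-model-7` (g3), 2026-08-27; lead g6 RULING 7w (1) on ref-3's LEDGER-3
row 50 scope (b).  Second half of `Models/FluxSurfacePolarRayDeriv.lean` (split only for the 400-line rule): that file proves the glued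
radius `ρ := rayRadius ψ R_c Z_c u` DIFFERENTIABLE on each panel with `ρ′ = −ρ·D_t/D_r`; this file closes the loop.
Elementary real analysis, [folklore]; no equilibrium, no device.

WHAT IS PROVED:
* §4 `periodic_rayProfile` / `periodic_rayRadius` / `periodic_loop`: everything is `2π`-periodic in the direction `θ`;
  `continuous_of_periodic_of_continuousOn_Icc`: a `T`-periodic real function continuous on one closed period is continuous (the
  seam `θ = 0 ≡ 2π` needs no extra panel); `eq_of_periodic_of_eqOn_Icc`.
  **`safetyFactorE_eq_polar_rayRadius`** — ★ #88's `(6.35)` identity FOR THE GLUED RADIUS: if on one period `[0, 2π]` the level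
  identity `ψ(ray_θ ρ(θ)) = u` holds and `ρ` is continuous (both delivered panel by panel by the glue's `rayRadius_spec` /
  `continuousOn_rayRadius`, pasted with `ContinuousOn.union_of_isClosed`), `ρ > 0`, `ψ` Fréchet-differentiable at the loop points
  with radial derivative `D_r ≠ 0`, and `R > 0` on the loop, then
  `safetyFactorE F ψ (loop R_c Z_c ρ) (2π) = (F/2π) ∫₀^{2π} ρ(θ)/(R(θ)·|D_r(θ)|) dθ` — the differentiability of `ρ` and the
  differentiated level condition that #88 ASSUMED are now THEOREMS (Deriv §1–§3 + periodicity), so the glue's certified θ-integral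
  bracket (`panel_integral_bounds` / `sum_panel_bounds` with `D = D_r`) IS a bracket of `(2π/F)·q` for every such surface.
* §4b `partial_s_eq_of_hasDerivAt` / `radialDeriv_eq_of_hasDerivAt` (ref-3 row 50 scope (a)): a panel certificate's 1-D radial
  derivative `HasDerivAt (s ↦ ψ(ray_θ s)) D s` IS `∂_s` of the 2-D derivative (`L(0,1) = D`, `D_r = D`) once `ψ` is differentiable at
  the point — so «`D ≥ d⁻ > 0`» in a panel file discharges «`∂_s ≠ 0`».
* §5 `contDiffOn_rayRadius` — `ρ ∈ C¹[a, b]`: under the panel hypotheses (`a < b`), if `ψ` (uncurried) is `C¹` on an open set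
  containing the loop points over `[a, b]` and `D_r ≠ 0` there, then `ρ` has the continuous derivative `rayRadiusDeriv`
  (`= −ρ·D_t/D_r` built from `fderiv ℝ ψ (γ θ)`) within `[a, b]` at every point and `ContDiffOn ℝ 1 ρ [a, b]` — the literal
  sentence of RULING 7w (1); it is what a FIRST-ORDER panel quadrature (memo AM49 §F2: «first order needs the ρ′ lemma») starts from.
MODELLED: nothing.  NOT CLAIMED: any value for any equilibrium; star-shapedness of any particular surface; that an instance's
code-list `D` is `D_r` (per-instance kernel fact).
-/

noncomputable section

open Real Set Filter Topology Asymptotics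
open Literature.MathematicalPhysics.MHD.GradShafranov

namespace Summit.Ventures.FusionMHD.Models

namespace PolarRay

/-! ## §4 The whole loop: periodicity in `θ`, continuity from one period, and ★ #88's `(6.35)` identity for the GLUED `ρ` -/

section loopAssembly

variable {ψ : ℝ → ℝ → ℝ} {Rc Zc u : ℝ}

/-- The ray profile is `2π`-periodic in the direction `θ`. [folklore] -/
theorem periodic_rayProfile (ψ : ℝ → ℝ → ℝ) (Rc Zc s : ℝ) :
    Function.Periodic (fun θ => rayProfile ψ Rc Zc θ s) (2 * π) := by
  intro θ
  simp only [rayProfile, cos_add_two_pi, sin_add_two_pi]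

/-- Hence the glued ray radius is `2π`-periodic. [folklore] -/
theorem periodic_rayRadius (ψ : ℝ → ℝ → ℝ) (Rc Zc u : ℝ) :
    Function.Periodic (rayRadius ψ Rc Zc u) (2 * π) := by
  intro θ
  unfold rayRadius rootSet
  simp only [periodic_rayProfile ψ Rc Zc _ θ]

/-- … and so is the polar loop of any `2π`-periodic radius function. [folklore] -/
theorem periodic_loop {ρ : ℝ → ℝ} (hρ : Function.Periodic ρ (2 * π)) (Rc Zc : ℝ) :
    Function.Periodic (loop Rc Zc ρ) (2 * π) := by
  intro θ
  simp only [loop, hρ θ, cos_add_two_pi, sin_add_two_pi]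

/-- A `T`-periodic real function continuous on one closed period `[0, T]` is continuous. [folklore] -/
theorem continuous_of_periodic_of_continuousOn_Icc {f : ℝ → ℝ} {T : ℝ} (hper : Function.Periodic f T) (hT : 0 < T)
    (hc : ContinuousOn f (Icc 0 T)) : Continuous f := by
  -- continuity at every point of [0, T)
  have hbase : ∀ y ∈ Ico 0 T, ContinuousAt f y := by
    intro y hy
    rcases hy.1.eq_or_lt with h0 | hpos
    · -- y = 0: right-continuity from [0, T], left-continuity transported from T by periodicity
      rw [← h0]
      rw [continuousAt_iff_continuous_left_right]
      constructor
      · have hT' : ContinuousWithinAt f (Iic T) T := (continuousWithinAt_Icc_iff_Iic hT).1 (hc T ⟨hT.le, le_rfl⟩)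
        have hg : ContinuousWithinAt (fun t : ℝ => t + T) (Iic 0) 0 := (continuous_add_const T).continuousWithinAt
        have hmaps : MapsTo (fun t : ℝ => t + T) (Iic (0:ℝ)) (Iic T) := by
          intro t ht; simp only [mem_Iic] at ht ⊢; linarith
        have hcomp : ContinuousWithinAt (f ∘ fun t : ℝ => t + T) (Iic 0) 0 :=
          ContinuousWithinAt.comp_of_eq hT' hg hmaps (by simp)
        have e : f ∘ (fun t : ℝ => t + T) = f := funext fun t => hper t
        rwa [e] at hcomp
      · exact (continuousWithinAt_Icc_iff_Ici hT).1 (hc 0 ⟨le_rfl, hT.le⟩)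
    · exact hc.continuousAt (Icc_mem_nhds hpos hy.2)
  rw [continuous_iff_continuousAt]
  intro x
  -- x = y + n • T with y ∈ [0, T)
  obtain ⟨n, hn, -⟩ := existsUnique_zsmul_near_of_pos' hT x
  have hy : ContinuousAt f (x - n • T) := hbase _ hn
  have e : f = f ∘ fun t => t - n • T := by
    funext t; simp only [Function.comp_apply]; exact (hper.sub_zsmul_eq n).symm
  rw [e]
  exact ContinuousAt.comp_of_eq hy ((continuous_id.sub continuous_const).continuousAt) rfl

/-- A `T`-periodic function equal to `u` on one closed period is `u` everywhere. [folklore] -/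
theorem eq_of_periodic_of_eqOn_Icc {f : ℝ → ℝ} {T u : ℝ} (hper : Function.Periodic f T) (hT : 0 < T)
    (h : ∀ y ∈ Icc 0 T, f y = u) (x : ℝ) : f x = u := by
  obtain ⟨y, hy, hxy⟩ := hper.exists_mem_Ico₀ hT x
  rw [hxy]; exact h y (Ico_subset_Icc_self hy)

/-- **★ #88's `(6.35)` IDENTITY FOR THE GLUED RADIUS — every surface at once.**  Let `ρ := rayRadius ψ R_c Z_c u`.  Suppose
on one period `[0, 2π]`: `ψ(ray_θ ρ(θ)) = u` and `ρ` continuous (both delivered panel by panel by the glue's `rayRadius_spec` /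
`continuousOn_rayRadius`), `ρ > 0`, `ψ` Fréchet-differentiable at the loop point `γ(θ)` with derivative `L θ`, radial
derivative `D_r(θ) ≠ 0` and `R(θ) > 0`.  Then `ρ` is differentiable at every `θ` (§1–§3, with periodicity at the seam) and
Freidberg's `q = (F/2π)∮ dl/(R²B_p)` over the loop `γ = loop R_c Z_c ρ` equals `(F/2π) ∫₀^{2π} ρ/(R·|D_r|) dθ`.
[cite: Freidberg2014, §6.3.5 eq. (6.35)] -/
theorem safetyFactorE_eq_polar_rayRadius {F : ℝ} {L : ℝ → (ℝ × ℝ →L[ℝ] ℝ)}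
    (hlev : ∀ θ ∈ Icc 0 (2 * π), rayProfile ψ Rc Zc θ (rayRadius ψ Rc Zc u θ) = u)
    (hcont : ContinuousOn (rayRadius ψ Rc Zc u) (Icc 0 (2 * π)))
    (hρ0 : ∀ θ ∈ uIcc 0 (2 * π), 0 < rayRadius ψ Rc Zc u θ)
    (hψ : ∀ θ ∈ uIcc 0 (2 * π), HasFDerivAt (fun p : ℝ × ℝ => ψ p.1 p.2) (L θ) (loop Rc Zc (rayRadius ψ Rc Zc u) θ))
    (hDr : ∀ θ ∈ uIcc 0 (2 * π), radialDeriv (L θ (1, 0)) (L θ (0, 1)) θ ≠ 0)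
    (hR : ∀ θ ∈ uIcc 0 (2 * π), 0 < (loop Rc Zc (rayRadius ψ Rc Zc u) θ).1) :
    safetyFactorE F ψ (loop Rc Zc (rayRadius ψ Rc Zc u)) (2 * π)
      = F / (2 * π) * ∫ θ in (0 : ℝ)..(2 * π),
          rayRadius ψ Rc Zc u θ / ((loop Rc Zc (rayRadius ψ Rc Zc u) θ).1 * |radialDeriv (L θ (1, 0)) (L θ (0, 1)) θ|) := by
  set ρ := rayRadius ψ Rc Zc u with hρdef
  have hper : Function.Periodic ρ (2 * π) := periodic_rayRadius ψ Rc Zc u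
  -- the level identity and continuity hold EVERYWHERE by periodicity
  have hG : Function.Periodic (fun θ => rayProfile ψ Rc Zc θ (ρ θ)) (2 * π) := by
    intro θ; simp only [hper θ, periodic_rayProfile ψ Rc Zc _ θ]
  have hlev' : ∀ θ, rayProfile ψ Rc Zc θ (ρ θ) = u := eq_of_periodic_of_eqOn_Icc hG two_pi_pos hlev
  have hρc : Continuous ρ := continuous_of_periodic_of_continuousOn_Icc hper two_pi_pos hcont
  -- pointwise derivative of ρ and of the level function
  have hderiv : ∀ θ ∈ uIcc 0 (2 * π), HasDerivAt ρ
      (-(ρ θ * tangentialDeriv (L θ (1, 0)) (L θ (0, 1)) θ) / radialDeriv (L θ (1, 0)) (L θ (0, 1)) θ) θ := by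
    intro θ hθ
    have hψ' : HasFDerivAt (fun p : ℝ × ℝ => ψ p.1 p.2) (L θ) (rayPoint Rc Zc θ (ρ θ)) := by
      rw [← loop_eq_rayPoint]; exact hψ θ hθ
    have hL := hasFDerivAt_rayProfile hψ'
    have hlevel_ev : ∀ᶠ t in 𝓝 θ, (fun p : ℝ × ℝ => rayProfile ψ Rc Zc p.1 p.2) (t, ρ t)
        = (fun p : ℝ × ℝ => rayProfile ψ Rc Zc p.1 p.2) (θ, ρ θ) :=
      Eventually.of_forall fun t => by simp only [hlev']
    have h := hasDerivAt_of_implicit (F := fun p : ℝ × ℝ => rayProfile ψ Rc Zc p.1 p.2) (g := ρ) (x₀ := θ)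
      hρc.continuousAt hlevel_ev hL (by rw [rayProfile_partial_s]; exact hDr θ hθ)
    rw [rayProfile_partial_theta, rayProfile_partial_s] at h
    exact h
  have hlevel : ∀ θ ∈ uIcc 0 (2 * π), HasDerivAt (fun t => ψ (loop Rc Zc ρ t).1 (loop Rc Zc ρ t).2) 0 θ := by
    intro θ _
    have e : (fun t => ψ (loop Rc Zc ρ t).1 (loop Rc Zc ρ t).2) = fun _ => u := funext fun t => hlev' t
    rw [e]; exact hasDerivAt_const θ u
  exact safetyFactorE_eq_polar (fun θ hθ => hderiv θ hθ) hρ0 hψ hlevel hDr hR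

end loopAssembly

/-! ## §4b Identifying a certificate's 1-D radial derivative with `∂_s` of the 2-D derivative (ref-3 row 50 scope (a)) -/

section identification

variable {ψ : ℝ → ℝ → ℝ} {Rc Zc : ℝ}

/-- The `s`-section of a Fréchet-differentiable `F : ℝ × ℝ → ℝ` has derivative `L(0,1)`. [folklore] -/
theorem hasDerivAt_section_snd {F : ℝ × ℝ → ℝ} {θ s : ℝ} {L : ℝ × ℝ →L[ℝ] ℝ} (hF : HasFDerivAt F L (θ, s)) :
    HasDerivAt (fun t => F (θ, t)) (L (0, 1)) s := by
  have hl : HasDerivAt (fun t : ℝ => ((θ, t) : ℝ × ℝ)) ((0 : ℝ), (1 : ℝ)) s :=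
    (hasDerivAt_const s θ).prodMk (hasDerivAt_id s)
  exact hF.comp_hasDerivAt s hl

/-- **IDENTIFICATION.**  If the uncurried ray profile is Fréchet-differentiable at `(θ, s)` with derivative `L` and a panel
certificate supplies a 1-D radial derivative `HasDerivAt (s ↦ ψ(ray_θ s)) D s` (e.g. the derived code list of
`Models/CerfonFreidbergIterLikePolarPanel.hasDerivAt_rayProfile`), then `L(0,1) = D`: the certificate's `D ≥ d⁻ > 0` IS the
hypothesis `∂_s ≠ 0` of `FluxSurfacePolarRayDeriv`, and (with `rayProfile_partial_s`) `D = D_r`. [folklore] -/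
theorem partial_s_eq_of_hasDerivAt {θ s D : ℝ} {L : ℝ × ℝ →L[ℝ] ℝ}
    (hL : HasFDerivAt (fun p : ℝ × ℝ => rayProfile ψ Rc Zc p.1 p.2) L (θ, s))
    (hD : HasDerivAt (rayProfile ψ Rc Zc θ) D s) : L (0, 1) = D :=
  (hasDerivAt_section_snd hL).unique hD

/-- … in `ψ`'s vocabulary: `ψ` differentiable at the ray point with derivative `Lψ` and a certified 1-D radial derivative `D`
give `radialDeriv ψ_R ψ_Z θ = D`. [folklore] -/
theorem radialDeriv_eq_of_hasDerivAt {θ s D : ℝ} {Lψ : ℝ × ℝ →L[ℝ] ℝ}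
    (hψ : HasFDerivAt (fun p : ℝ × ℝ => ψ p.1 p.2) Lψ (rayPoint Rc Zc θ s))
    (hD : HasDerivAt (rayProfile ψ Rc Zc θ) D s) : radialDeriv (Lψ (1, 0)) (Lψ (0, 1)) θ = D := by
  rw [← rayProfile_partial_s (θ := θ) (s := s) Lψ]
  exact partial_s_eq_of_hasDerivAt (hasFDerivAt_rayProfile hψ) hD

end identification

/-! ## §5 C¹: with `ψ` of class C¹ near the loop, `ρ′` is continuous on the panel and `ρ ∈ C¹([a, b])` -/

section contDiff

variable {ψ : ℝ → ℝ → ℝ} {Rc Zc u a b s₁ s₂ : ℝ}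

/-- THE DERIVATIVE FIELD of the glued radius in `ψ`'s vocabulary: `ρ′(θ) = −ρ(θ)·D_t(θ)/D_r(θ)` with `D_r, D_t` the radial /
tangential derivatives built from the Fréchet derivative `fderiv ℝ ψ (γ(θ))` at the loop point. [folklore] -/
def rayRadiusDeriv (ψ : ℝ → ℝ → ℝ) (Rc Zc u θ : ℝ) : ℝ :=
  -(rayRadius ψ Rc Zc u θ
      * tangentialDeriv (fderiv ℝ (fun p : ℝ × ℝ => ψ p.1 p.2) (loop Rc Zc (rayRadius ψ Rc Zc u) θ) (1, 0))
          (fderiv ℝ (fun p : ℝ × ℝ => ψ p.1 p.2) (loop Rc Zc (rayRadius ψ Rc Zc u) θ) (0, 1)) θ)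
    / radialDeriv (fderiv ℝ (fun p : ℝ × ℝ => ψ p.1 p.2) (loop Rc Zc (rayRadius ψ Rc Zc u) θ) (1, 0))
        (fderiv ℝ (fun p : ℝ × ℝ => ψ p.1 p.2) (loop Rc Zc (rayRadius ψ Rc Zc u) θ) (0, 1)) θ

/-- **`ρ ∈ C¹` ON THE PANEL.**  Under the panel hypotheses on `[a, b] × [s₁, s₂]` (`a < b`), if `ψ` (uncurried) is `C¹` on an
open set `U` containing the loop points `γ(θ)`, `θ ∈ [a, b]`, and the radial derivative `D_r(θ) ≠ 0` there, then
`θ ↦ ρ(θ)` has the derivative `rayRadiusDeriv` within `[a, b]` at every point, that derivative is CONTINUOUS on `[a, b]`,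
and `ContDiffOn ℝ 1 ρ [a, b]`. [folklore] -/
theorem contDiffOn_rayRadius
    (hF : ContinuousOn (fun p : ℝ × ℝ => rayProfile ψ Rc Zc p.1 p.2) (Icc a b ×ˢ Icc s₁ s₂))
    (hab : a < b) (hs₁ : 0 < s₁) (hs : s₁ ≤ s₂)
    (hin : ∀ θ ∈ Icc a b, ∀ s, 0 < s → s ≤ s₁ → rayProfile ψ Rc Zc θ s < u)
    (hmono : ∀ θ ∈ Icc a b, StrictMonoOn (rayProfile ψ Rc Zc θ) (Icc s₁ s₂))
    (hout : ∀ θ ∈ Icc a b, u < rayProfile ψ Rc Zc θ s₂)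
    {U : Set (ℝ × ℝ)} (hU : IsOpen U) (hψ : ContDiffOn ℝ 1 (fun p : ℝ × ℝ => ψ p.1 p.2) U)
    (hγU : ∀ θ ∈ Icc a b, loop Rc Zc (rayRadius ψ Rc Zc u) θ ∈ U)
    (hDr : ∀ θ ∈ Icc a b,
      radialDeriv (fderiv ℝ (fun p : ℝ × ℝ => ψ p.1 p.2) (loop Rc Zc (rayRadius ψ Rc Zc u) θ) (1, 0))
        (fderiv ℝ (fun p : ℝ × ℝ => ψ p.1 p.2) (loop Rc Zc (rayRadius ψ Rc Zc u) θ) (0, 1)) θ ≠ 0) :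
    (∀ θ ∈ Icc a b, HasDerivWithinAt (rayRadius ψ Rc Zc u) (rayRadiusDeriv ψ Rc Zc u θ) (Icc a b) θ)
      ∧ ContinuousOn (rayRadiusDeriv ψ Rc Zc u) (Icc a b)
      ∧ ContDiffOn ℝ 1 (rayRadius ψ Rc Zc u) (Icc a b) := by
  set ρ := rayRadius ψ Rc Zc u with hρdef
  set Ψ : ℝ × ℝ → ℝ := fun p => ψ p.1 p.2 with hΨ
  -- ψ is differentiable at the loop points, with derivative fderiv
  have hdiff : ∀ θ ∈ Icc a b, HasFDerivAt Ψ (fderiv ℝ Ψ (loop Rc Zc ρ θ)) (loop Rc Zc ρ θ) := by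
    intro θ hθ
    exact ((hψ.differentiableOn one_ne_zero).differentiableAt (hU.mem_nhds (hγU θ hθ))).hasFDerivAt
  have hderiv : ∀ θ ∈ Icc a b, HasDerivWithinAt ρ (rayRadiusDeriv ψ Rc Zc u θ) (Icc a b) θ := by
    intro θ hθ
    exact hasDerivWithinAt_rayRadius_of_psi hF hs₁ hs hin hmono hout hθ (hdiff θ hθ) (hDr θ hθ)
  -- continuity of the derivative field
  have hρc : ContinuousOn ρ (Icc a b) := continuousOn_rayRadius hF hs₁ hs hin hmono hout
  have hγc : ContinuousOn (loop Rc Zc ρ) (Icc a b) := by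
    apply ContinuousOn.prodMk
    · exact continuousOn_const.add (hρc.mul continuous_cos.continuousOn)
    · exact continuousOn_const.add (hρc.mul continuous_sin.continuousOn)
  have hfd : ContinuousOn (fderiv ℝ Ψ) U := hψ.continuousOn_fderiv_of_isOpen hU le_rfl
  have hfdγ : ContinuousOn (fun θ => fderiv ℝ Ψ (loop Rc Zc ρ θ)) (Icc a b) := hfd.comp hγc hγU
  have hP : ContinuousOn (fun θ => fderiv ℝ Ψ (loop Rc Zc ρ θ) (1, 0)) (Icc a b) := hfdγ.clm_apply continuousOn_const
  have hQ : ContinuousOn (fun θ => fderiv ℝ Ψ (loop Rc Zc ρ θ) (0, 1)) (Icc a b) := hfdγ.clm_apply continuousOn_const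
  have hDrc : ContinuousOn (fun θ => radialDeriv (fderiv ℝ Ψ (loop Rc Zc ρ θ) (1, 0)) (fderiv ℝ Ψ (loop Rc Zc ρ θ) (0, 1)) θ)
      (Icc a b) := by
    unfold radialDeriv
    exact (hP.mul continuous_cos.continuousOn).add (hQ.mul continuous_sin.continuousOn)
  have hDtc : ContinuousOn
      (fun θ => tangentialDeriv (fderiv ℝ Ψ (loop Rc Zc ρ θ) (1, 0)) (fderiv ℝ Ψ (loop Rc Zc ρ θ) (0, 1)) θ) (Icc a b) := by
    unfold tangentialDeriv
    exact (hP.neg.mul continuous_sin.continuousOn).add (hQ.mul continuous_cos.continuousOn)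
  have hDc : ContinuousOn (rayRadiusDeriv ψ Rc Zc u) (Icc a b) := by
    unfold rayRadiusDeriv
    exact ((hρc.mul hDtc).neg).div hDrc hDr
  refine ⟨hderiv, hDc, ?_⟩
  -- C¹ on [a, b]
  rw [contDiffOn_one_iff_derivWithin (uniqueDiffOn_Icc hab)]
  refine ⟨fun θ hθ => (hderiv θ hθ).differentiableWithinAt, ?_⟩
  exact hDc.congr fun θ hθ => (hderiv θ hθ).derivWithin (uniqueDiffOn_Icc hab θ hθ)

end contDiff

/-! ## §6 (APPEND 2026-08-27, g3) Up–down symmetry: even ray data ⇒ `∫₀^{2π} = 2∫₀^π` (half the panels for a symmetric surface) -/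

section symmetry

variable {ψ : ℝ → ℝ → ℝ} {Rc Zc u : ℝ}

/-- For a flux MIRROR-SYMMETRIC about the horizontal line through the centre, `ψ(R, Z_c − t) = ψ(R, Z_c + t)` (an up–down
symmetric equilibrium with the centre on the midplane), the ray profile is EVEN in the direction: `ψ(ray_{−θ} s) = ψ(ray_θ s)`.
[folklore] -/
theorem rayProfile_neg_of_symm (hsym : ∀ R t : ℝ, ψ R (Zc - t) = ψ R (Zc + t)) (θ s : ℝ) :
    rayProfile ψ Rc Zc (-θ) s = rayProfile ψ Rc Zc θ s := by
  simp only [rayProfile, cos_neg, sin_neg, mul_neg]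
  rw [← sub_eq_add_neg]
  exact hsym _ _

/-- … hence so is the glued ray radius: `ρ(−θ) = ρ(θ)`. [folklore] -/
theorem rayRadius_neg_of_symm (hsym : ∀ R t : ℝ, ψ R (Zc - t) = ψ R (Zc + t)) (θ : ℝ) :
    rayRadius ψ Rc Zc u (-θ) = rayRadius ψ Rc Zc u θ := by
  unfold rayRadius rootSet
  simp only [rayProfile_neg_of_symm hsym]

/-- … and the polar integrand, for a radial-derivative field with the same symmetry `D(−θ, s) = D(θ, s)`. [folklore] -/
theorem polarIntegrand_neg_of_symm {D : ℝ → ℝ → ℝ} (hsym : ∀ R t : ℝ, ψ R (Zc - t) = ψ R (Zc + t))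
    (hD : ∀ θ s : ℝ, D (-θ) s = D θ s) (θ : ℝ) :
    polarIntegrand ψ Rc Zc u D (-θ) = polarIntegrand ψ Rc Zc u D θ := by
  unfold polarIntegrand
  rw [rayRadius_neg_of_symm hsym, hD, cos_neg]

/-- **EVEN + `2π`-PERIODIC ⇒ `∫₀^{2π} f = 2 ∫₀^π f`** (for `f` interval-integrable on `[−π, 0]` and `[0, π]`). [folklore] -/
theorem integral_two_pi_eq_two_mul_of_even {f : ℝ → ℝ} (hper : Function.Periodic f (2 * π)) (heven : ∀ x, f (-x) = f x)
    (h₁ : IntervalIntegrable f MeasureTheory.volume (-π) 0) (h₂ : IntervalIntegrable f MeasureTheory.volume 0 π) :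
    ∫ x in (0 : ℝ)..(2 * π), f x = 2 * ∫ x in (0 : ℝ)..π, f x := by
  have hshift : ∫ x in (0 : ℝ)..(0 + 2 * π), f x = ∫ x in (-π)..(-π + 2 * π), f x := hper.intervalIntegral_add_eq 0 (-π)
  have e1 : (0 : ℝ) + 2 * π = 2 * π := by ring
  have e2 : -π + 2 * π = π := by ring
  rw [e1, e2] at hshift
  rw [hshift, ← intervalIntegral.integral_add_adjacent_intervals h₁ h₂]
  have hneg : ∫ x in (-π)..(0 : ℝ), f x = ∫ x in (0 : ℝ)..π, f x := by
    have h := intervalIntegral.integral_comp_neg (a := 0) (b := π) (f := f)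
    simp only [neg_zero] at h
    rw [← h]
    exact intervalIntegral.integral_congr fun x _ => heven x
  rw [hneg]
  ring

/-- **HALF-LOOP FORM for an up–down symmetric surface**: with the symmetric data above and the polar integrand interval-integrable on
`[−π, 0]` and `[0, π]` (e.g. continuous, from the glue) and `D` `2π`-periodic in `θ` (any field built from `cos θ`, `sin θ`),
`∫₀^{2π} ρ/(R·D) dθ = 2 ∫₀^π ρ/(R·D) dθ` — certify `[0, π]` only. [folklore] -/
theorem polar_integral_two_pi_eq_two_mul_of_symm {D : ℝ → ℝ → ℝ} (hsym : ∀ R t : ℝ, ψ R (Zc - t) = ψ R (Zc + t))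
    (hD : ∀ θ s : ℝ, D (-θ) s = D θ s) (hDper : ∀ θ s : ℝ, D (θ + 2 * π) s = D θ s)
    (h₁ : IntervalIntegrable (polarIntegrand ψ Rc Zc u D) MeasureTheory.volume (-π) 0)
    (h₂ : IntervalIntegrable (polarIntegrand ψ Rc Zc u D) MeasureTheory.volume 0 π) :
    ∫ θ in (0 : ℝ)..(2 * π), polarIntegrand ψ Rc Zc u D θ = 2 * ∫ θ in (0 : ℝ)..π, polarIntegrand ψ Rc Zc u D θ := by
  have hper : Function.Periodic (polarIntegrand ψ Rc Zc u D) (2 * π) := by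
    intro θ
    unfold polarIntegrand
    rw [periodic_rayRadius ψ Rc Zc u θ, cos_add_two_pi, hDper]
  exact integral_two_pi_eq_two_mul_of_even hper (polarIntegrand_neg_of_symm hsym hD) h₁ h₂

end symmetry

end PolarRay

end Summit.Ventures.FusionMHD.Models

end
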